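import Mathlib
import Literature.Analysis.FluidPDE.SteadyNSLatticePersistence
import HarnessLib

/-!
# Stub `stub_galerkinNewtonKantorovich` of crux `stmt-AnomalousDissipation-11414`

Line `registered` of `Summit.AnomalousDissipation.AnomalousDissipation.Theses.WindLine.WindyGalerkinSteadyZerothLaw`
(route WindLine).  This file proves the ABSTRACT functional-analytic core of the Galerkin shadowing argument
(Brezzi–Rappaz–Raviart 1980, Thm. 3, in chord-iteration / Newton–Kantorovich form) on an arbitrary real Banach
space `E`.

Let `G(x) = c • x + D x + B(x,x) − F` with `B` bounded bilinear vanish at `x₀`; its derivative there is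
`L = c•1 + (D + K)` with `K w = B(x₀,w) + B(w,x₀)`.  Assume `D + K` is compact and `L` is injective (`c ≠ 0`), and
let `P N` be idempotents of norm `≤ 1` converging strongly to the identity.  Then for all large `N` there are
Galerkin zeros `x_N = P_N x_N`, `P_N G(x_N) = 0`, and `x_N → x₀`.

Proof.
* `L` is a linear homeomorphism (`SteadyLattice.exists_equiv_of_injective`, the packaged Fredholm alternative).
* `gnk_tails`: `‖(1 − P_N) S‖ → 0` for a compact `S` (finite `ε`-net of the image of the unit ball).
* `gnk_chord`: the chord map `Φ_N(y) = y − P_N L⁻¹ P_N G(P_N x₀ + y)` is a `1/2`-contraction of the complete set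
  `{y = P_N y, ‖y‖ ≤ ρ}` once `‖(1 − P_N)(D + K)‖`, `‖P_N x₀ − x₀‖` and `‖G(P_N x₀)‖` are small (Banach fixed point),
  using `P_N L y = L y − (1 − P_N)(D + K) y` on `range P_N` and the quadratic Taylor formula
  `G(x₀ + h) = L h + B(h,h)` (`gnk_quadLipschitz` bounds the remainder).
* `gnk_injective`: `P_N L⁻¹` is injective on `range P_N` as soon as `‖(1 − P_N)(D + K)‖ < |c|`, so the fixed point
  `P_N L⁻¹ P_N G(x_N) = 0` is a Galerkin zero; `‖x_N − x₀‖ ≤ ‖P_N x₀ − x₀‖ + 2‖L⁻¹‖ ‖G(P_N x₀)‖ → 0`.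
-/

noncomputable section

-- D-0017: single-problem summit ⇒ the duplicated namespace segment is by design.
set_option linter.dupNamespace false

open scoped Topology NNReal
open Filter
open Literature.Analysis.FluidPDE

namespace Summit.AnomalousDissipation.AnomalousDissipation.Theorems.WindLineWindyGalerkinSteadyZerothLaw

/-- **Uniform tails of a compact operator.**  If `S` is a compact operator and the `P N` are contractions
converging strongly to the identity, then `‖(1 - P N) ∘ S‖ → 0`: for every `ε > 0`, eventually
`‖S x - P N (S x)‖ ≤ ε ‖x‖` for all `x` (finite `ε/3`-net of the compact image of the unit ball). -/
theorem gnk_tails {E : Type*} [NormedAddCommGroup E] [NormedSpace ℝ E]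
    (S : E →L[ℝ] E) (P : ℕ → E →L[ℝ] E) (hS : IsCompactOperator S)
    (hP2 : ∀ N x, ‖P N x‖ ≤ ‖x‖) (hP3 : ∀ x, Tendsto (fun N => P N x) atTop (𝓝 x))
    {ε : ℝ} (hε : 0 < ε) :
    ∀ᶠ N in atTop, ∀ x, ‖S x - P N (S x)‖ ≤ ε * ‖x‖ := by
  obtain ⟨C, hC, hSC⟩ := hS.image_closedBall_subset_compact 1
  have hε3 : 0 < ε / 3 := by positivity
  obtain ⟨t, -, htf, hCt⟩ := hC.finite_cover_balls hε3
  have hev : ∀ᶠ N in atTop, ∀ y ∈ t, dist (P N y) y < ε / 3 :=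
    (htf.eventually_all).2 fun y _ => Metric.tendsto_nhds.1 (hP3 y) _ hε3
  filter_upwards [hev] with N hN
  have hU : ‖S - (P N).comp S‖ ≤ ε := by
    refine ContinuousLinearMap.opNorm_le_of_unit_norm hε.le fun x hx => ?_
    have hxC : S x ∈ C := hSC ⟨x, by simp [hx], rfl⟩
    obtain ⟨y, hy, hxy⟩ := Set.mem_iUnion₂.1 (hCt hxC)
    have h1 : ‖S x - y‖ < ε / 3 := by rwa [Metric.mem_ball, dist_eq_norm] at hxy
    have h2 : ‖y - P N y‖ < ε / 3 := by rw [← dist_eq_norm, dist_comm]; exact hN y hy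
    have h3 : ‖P N (S x - y)‖ < ε / 3 := (hP2 N _).trans_lt h1
    calc ‖(S - (P N).comp S) x‖ = ‖(S x - y) - P N (S x - y) + (y - P N y)‖ := by
          congr 1
          simp only [sub_apply, ContinuousLinearMap.comp_apply, map_sub]
          abel
      _ ≤ ‖S x - y‖ + ‖P N (S x - y)‖ + ‖y - P N y‖ :=
          (norm_add_le _ _).trans (add_le_add (norm_sub_le _ _) le_rfl)
      _ ≤ ε / 3 + ε / 3 + ε / 3 := add_le_add_three h1.le h3.le h2.le
      _ = ε := by ring
  intro x
  simpa using (S - (P N).comp S).le_of_opNorm_le hU x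

/-- **`P ∘ L⁻¹` is injective on `range P` once `‖(1 - P) T‖ < |c|`.**  With `L = c•1 + T` a linear
homeomorphism: if `P z = z` and `P (L⁻¹ z) = 0` then `z = 0`.  (Put `w = L⁻¹ z`; then `P w = 0` and
`c • w = P (T w) - T w`, so `|c| ‖w‖ ≤ δ ‖w‖` forces `w = 0`.) -/
theorem gnk_injective {E : Type*} [NormedAddCommGroup E] [NormedSpace ℝ E]
    (L : E ≃L[ℝ] E) (T P : E →L[ℝ] E) {c δ : ℝ} (hL : ∀ x, L x = c • x + T x)
    (hδ : ∀ x, ‖T x - P (T x)‖ ≤ δ * ‖x‖) (hδc : δ < |c|) {z : E} (hPz : P z = z)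
    (h0 : P (L.symm z) = 0) : z = 0 := by
  set w := L.symm z with hw
  have hz : c • w + T w = z := by rw [← hL, hw, ContinuousLinearEquiv.apply_symm_apply]
  have hPTw : P (T w) = z := by
    have h := congrArg P hz
    rwa [map_add, map_smul, h0, smul_zero, zero_add, hPz] at h
  have hcw : c • w = P (T w) - T w := by rw [hPTw, ← hz]; abel
  have hnorm : |c| * ‖w‖ ≤ δ * ‖w‖ := by
    calc |c| * ‖w‖ = ‖c • w‖ := by rw [norm_smul, Real.norm_eq_abs]
      _ = ‖T w - P (T w)‖ := by rw [hcw, norm_sub_rev]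
      _ ≤ δ * ‖w‖ := hδ w
  have hw0 : w = 0 := by
    by_contra hne
    have hpos : 0 < ‖w‖ := norm_pos_iff.2 hne
    have := mul_lt_mul_of_pos_right hδc hpos
    linarith
  rw [← hz, hw0, smul_zero, map_zero, add_zero]

/-- **Lipschitz bound for the quadratic remainder on a ball.**  For a bilinear `B` with
`‖B x y‖ ≤ C ‖x‖ ‖y‖`: `‖B(e+y₁,e+y₁) - B(e+y₂,e+y₂)‖ ≤ 2 C (‖e‖ + ρ) ‖y₁ - y₂‖` whenever `‖y₁‖, ‖y₂‖ ≤ ρ`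
(write the difference as `B(e+y₁, y₁-y₂) + B(y₁-y₂, e+y₂)`). -/
theorem gnk_quadLipschitz {E : Type*} [NormedAddCommGroup E] [NormedSpace ℝ E]
    (B : E → E → E) {C ρ : ℝ} (hC0 : 0 ≤ C) (hC : ∀ x y, ‖B x y‖ ≤ C * ‖x‖ * ‖y‖)
    (hsubl : ∀ x y z, B (x - y) z = B x z - B y z) (hsubr : ∀ x y z, B x (y - z) = B x y - B x z)
    (e y₁ y₂ : E) (n₁ : ‖y₁‖ ≤ ρ) (n₂ : ‖y₂‖ ≤ ρ) :
    ‖B (e + y₁) (e + y₁) - B (e + y₂) (e + y₂)‖ ≤ 2 * C * (‖e‖ + ρ) * ‖y₁ - y₂‖ := by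
  have key : B (e + y₁) (e + y₁) - B (e + y₂) (e + y₂) =
      B (e + y₁) (y₁ - y₂) + B (y₁ - y₂) (e + y₂) := by
    have hd : y₁ - y₂ = (e + y₁) - (e + y₂) := by abel
    rw [hd, hsubr, hsubl]; abel
  have m₁ : ‖e + y₁‖ ≤ ‖e‖ + ρ := (norm_add_le _ _).trans (add_le_add le_rfl n₁)
  have m₂ : ‖e + y₂‖ ≤ ‖e‖ + ρ := (norm_add_le _ _).trans (add_le_add le_rfl n₂)
  rw [key]
  calc ‖B (e + y₁) (y₁ - y₂) + B (y₁ - y₂) (e + y₂)‖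
        ≤ ‖B (e + y₁) (y₁ - y₂)‖ + ‖B (y₁ - y₂) (e + y₂)‖ := norm_add_le _ _
    _ ≤ C * ‖e + y₁‖ * ‖y₁ - y₂‖ + C * ‖y₁ - y₂‖ * ‖e + y₂‖ := add_le_add (hC _ _) (hC _ _)
    _ ≤ C * (‖e‖ + ρ) * ‖y₁ - y₂‖ + C * ‖y₁ - y₂‖ * (‖e‖ + ρ) := by gcongr
    _ = 2 * C * (‖e‖ + ρ) * ‖y₁ - y₂‖ := by ring

/-- **The chord map is a contraction (one Galerkin level).**  Let `L = c•1 + T` be a linear homeomorphism with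
`‖L⁻¹ w‖ ≤ M ‖w‖`, `P` an idempotent contraction with `‖T x - P (T x)‖ ≤ δ ‖x‖`, and `G` a map whose remainder
`y ↦ G (a + y) - L y` is `κ`-Lipschitz on the closed `ρ`-ball, with `M (δ + κ) ≤ 1/2` and `M ‖G a‖ ≤ ρ/2`.
Then the chord map `Φ y = y - P L⁻¹ P G(a + y)` has a fixed point `y = P y` with `‖y‖ ≤ 2 M ‖G a‖`, i.e.
`P L⁻¹ P G(a + y) = 0` (Banach fixed point on the complete set `{y | P y = y, ‖y‖ ≤ ρ}`; on `range P` one has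
`Φ y = P L⁻¹ ((1 - P) T y - P (G (a + y) - L y))`). -/
theorem gnk_chord {E : Type*} [NormedAddCommGroup E] [NormedSpace ℝ E] [CompleteSpace E]
    (L : E ≃L[ℝ] E) (T P : E →L[ℝ] E) (G : E → E) (a : E) {c M δ κ ρ : ℝ}
    (hL : ∀ x, L x = c • x + T x) (hM0 : 0 ≤ M) (hM : ∀ w, ‖L.symm w‖ ≤ M * ‖w‖)
    (hP1 : ∀ x, P (P x) = P x) (hP2 : ∀ x, ‖P x‖ ≤ ‖x‖)
    (hδ : ∀ x, ‖T x - P (T x)‖ ≤ δ * ‖x‖)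
    (hκ : ∀ y₁ y₂, ‖y₁‖ ≤ ρ → ‖y₂‖ ≤ ρ →
      ‖(G (a + y₁) - L y₁) - (G (a + y₂) - L y₂)‖ ≤ κ * ‖y₁ - y₂‖)
    (hρ : 0 ≤ ρ) (hcontr : M * (δ + κ) ≤ 1 / 2) (h0 : M * ‖G a‖ ≤ ρ / 2) :
    ∃ y, P y = y ∧ ‖y‖ ≤ 2 * M * ‖G a‖ ∧ P (L.symm (P (G (a + y)))) = 0 := by
  obtain ⟨Φ, hΦ⟩ : ∃ Φ : E → E, ∀ y, Φ y = y - P (L.symm (P (G (a + y)))) := ⟨_, fun _ => rfl⟩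
  -- the chord map on `range P`, rewritten through `L⁻¹ P L = 1 - L⁻¹ (1 - P) T`
  have key : ∀ y, P y = y → Φ y = P (L.symm ((T y - P (T y)) - P (G (a + y) - L y))) := by
    intro y hy
    have h1 : P (L y) = L y - (T y - P (T y)) := by
      rw [hL, map_add, map_smul, hy]; abel
    rw [hΦ]
    simp only [map_sub]
    rw [h1]
    simp only [map_sub, ContinuousLinearEquiv.symm_apply_apply, hy]
    abel
  -- Lipschitz constant `1/2` on `{y | P y = y, ‖y‖ ≤ ρ}`
  have lip : ∀ y₁ y₂, P y₁ = y₁ → P y₂ = y₂ → ‖y₁‖ ≤ ρ → ‖y₂‖ ≤ ρ →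
      ‖Φ y₁ - Φ y₂‖ ≤ 1 / 2 * ‖y₁ - y₂‖ := by
    intro y₁ y₂ h₁ h₂ n₁ n₂
    obtain ⟨u, hu⟩ : ∃ u, u = T (y₁ - y₂) - P (T (y₁ - y₂)) := ⟨_, rfl⟩
    obtain ⟨v, hv⟩ : ∃ v, v = (G (a + y₁) - L y₁) - (G (a + y₂) - L y₂) := ⟨_, rfl⟩
    have eq : Φ y₁ - Φ y₂ = P (L.symm (u - P v)) := by
      rw [key y₁ h₁, key y₂ h₂, hu, hv]
      simp only [map_sub]
      abel
    rw [eq]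
    calc ‖P (L.symm (u - P v))‖ ≤ ‖L.symm (u - P v)‖ := hP2 _
      _ ≤ M * ‖u - P v‖ := hM _
      _ ≤ M * (‖u‖ + ‖P v‖) := by gcongr; exact norm_sub_le _ _
      _ ≤ M * (δ * ‖y₁ - y₂‖ + κ * ‖y₁ - y₂‖) := by
          gcongr
          · rw [hu]; exact hδ _
          · rw [hv]; exact (hP2 _).trans (hκ y₁ y₂ n₁ n₂)
      _ = M * (δ + κ) * ‖y₁ - y₂‖ := by ring
      _ ≤ 1 / 2 * ‖y₁ - y₂‖ := by gcongr
  -- the complete set `s` and the Banach fixed-point theorem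
  obtain ⟨s, hs⟩ : ∃ s : Set E, s = {y | P y = y} ∩ Metric.closedBall 0 ρ := ⟨_, rfl⟩
  have hmem : ∀ {y}, y ∈ s ↔ P y = y ∧ ‖y‖ ≤ ρ := fun {y} => by simp [hs]
  have hρ0 : ‖(0 : E)‖ ≤ ρ := by simpa using hρ
  have h0s : (0 : E) ∈ s := hmem.2 ⟨map_zero P, hρ0⟩
  have hΦ0 : ‖Φ 0‖ ≤ M * ‖G a‖ := by
    rw [hΦ, zero_sub, norm_neg, add_zero]
    calc ‖P (L.symm (P (G a)))‖ ≤ ‖L.symm (P (G a))‖ := hP2 _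
      _ ≤ M * ‖P (G a)‖ := hM _
      _ ≤ M * ‖G a‖ := by gcongr; exact hP2 _
  have hmaps : Set.MapsTo Φ s s := by
    intro y hy
    obtain ⟨hPy, hny⟩ := hmem.1 hy
    refine hmem.2 ⟨?_, ?_⟩
    · rw [hΦ, map_sub, hP1, hPy]
    · have hl := lip y 0 hPy (map_zero P) hny hρ0
      rw [sub_zero] at hl
      calc ‖Φ y‖ = ‖(Φ y - Φ 0) + Φ 0‖ := by rw [sub_add_cancel]
        _ ≤ ‖Φ y - Φ 0‖ + ‖Φ 0‖ := norm_add_le _ _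
        _ ≤ 1 / 2 * ‖y‖ + M * ‖G a‖ := add_le_add hl hΦ0
        _ ≤ 1 / 2 * ρ + ρ / 2 := by gcongr
        _ = ρ := by ring
  have hsc : IsComplete s := by
    rw [hs]
    exact ((isClosed_eq P.continuous continuous_id').inter Metric.isClosed_closedBall).isComplete
  have hK : ContractingWith 2⁻¹ (hmaps.restrict Φ s s) := by
    refine ⟨two_inv_lt_one, LipschitzWith.of_dist_le_mul fun p q => ?_⟩
    obtain ⟨hp1, hp2⟩ := hmem.1 p.2
    obtain ⟨hq1, hq2⟩ := hmem.1 q.2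
    simp only [Subtype.dist_eq, Set.MapsTo.val_restrict_apply, dist_eq_norm, NNReal.coe_inv,
      NNReal.coe_ofNat]
    have := lip p q hp1 hq1 hp2 hq2
    rwa [one_div] at this
  obtain ⟨y, hys, hfix, -⟩ :=
    ContractingWith.exists_fixedPoint' hsc hmaps hK h0s (edist_ne_top _ _)
  obtain ⟨hPy, hny⟩ := hmem.1 hys
  have hfix' : Φ y = y := hfix
  refine ⟨y, hPy, ?_, ?_⟩
  · have hl := lip y 0 hPy (map_zero P) hny hρ0
    rw [sub_zero] at hl
    have h3 : ‖y‖ ≤ ‖Φ y - Φ 0‖ + ‖Φ 0‖ := by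
      calc ‖y‖ = ‖(Φ y - Φ 0) + Φ 0‖ := by rw [sub_add_cancel, hfix']
        _ ≤ ‖Φ y - Φ 0‖ + ‖Φ 0‖ := norm_add_le _ _
    linarith
  · have h := hfix'
    rw [hΦ] at h
    exact sub_eq_self.1 h

/-- **Abstract Galerkin / Newton–Kantorovich lemma** (stub `stub_galerkinNewtonKantorovich` of the line
`registered`; Brezzi–Rappaz–Raviart 1980, Thm. 3, in chord-iteration form).  On a real Banach space `E`, let
`G(x) = c • x + D x + B(x,x) − F` (`B` bounded bilinear) vanish at `x₀`, let `K w = B(x₀,w) + B(w,x₀)`, assume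
`D + K` is compact and `c•1 + (D + K)` is injective (`c ≠ 0`), and let the `P N` be idempotents of norm `≤ 1`
converging strongly to the identity.  Then there are Galerkin zeros: `x_N = P_N x_N` and
`P_N (c • x_N + D x_N + B(x_N,x_N)) = P_N F` for all large `N`, with `x_N → x₀`. -/
theorem stub_galerkinNewtonKantorovich :
    ∀ {E : Type} [NormedAddCommGroup E] [NormedSpace ℝ E] [CompleteSpace E]
      (c : ℝ) (D K : E →L[ℝ] E) (B : E → E → E) (x₀ F : E) (P : ℕ → E →L[ℝ] E),
      c ≠ 0 → IsBoundedBilinearMap ℝ (fun p : E × E => B p.1 p.2) →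
      (∀ w, K w = B x₀ w + B w x₀) → IsCompactOperator (D + K) →
      (∀ w, c • w + (D + K) w = 0 → w = 0) →
      c • x₀ + D x₀ + B x₀ x₀ = F →
      (∀ N x, P N (P N x) = P N x) → (∀ N x, ‖P N x‖ ≤ ‖x‖) →
      (∀ x, Tendsto (fun N => P N x) atTop (𝓝 x)) →
      ∃ x : ℕ → E, (∀ᶠ N in atTop, P N (x N) = x N ∧ P N (c • x N + D (x N) + B (x N) (x N)) = P N F) ∧
        Tendsto x atTop (𝓝 x₀) := by
  intro E _ _ _ c D K B x₀ F P hc hB hK hcpt hinj hx₀ hP1 hP2 hP3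
  -- (0) the linearisation `L = c•1 + (D + K)` is a linear homeomorphism (Fredholm alternative)
  obtain ⟨L, hL⟩ := SteadyLattice.exists_equiv_of_injective hcpt hc hinj
  obtain ⟨M, hM0, hMle⟩ : ∃ M : ℝ, 0 ≤ M ∧ ∀ w, ‖L.symm w‖ ≤ M * ‖w‖ :=
    ⟨‖(L.symm : E →L[ℝ] E)‖, norm_nonneg _, fun w => (L.symm : E →L[ℝ] E).le_opNorm w⟩
  -- bilinear bookkeeping
  have hBadd_l : ∀ x y z, B (x + y) z = B x z + B y z := fun x y z => by
    simpa using hB.add_left x y z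
  have hBadd_r : ∀ x y z, B x (y + z) = B x y + B x z := fun x y z => by
    simpa using hB.add_right x y z
  have hBsub_l : ∀ x y z, B (x - y) z = B x z - B y z := fun x y z => by
    simpa using hB.map_sub_left (x := x) (y := y) (z := z)
  have hBsub_r : ∀ x y z, B x (y - z) = B x y - B x z := fun x y z => by
    simpa using hB.map_sub_right (x := x) (y := y) (z := z)
  obtain ⟨Cb, hCb0, hCb⟩ : ∃ C : ℝ, 0 < C ∧ ∀ x y, ‖B x y‖ ≤ C * ‖x‖ * ‖y‖ := by
    obtain ⟨C, hC0, hC⟩ := hB.bound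
    exact ⟨C, hC0, fun x y => by simpa using hC x y⟩
  -- the map `G` and its quadratic Taylor formula at `x₀`
  obtain ⟨G, hG⟩ : ∃ G : E → E, ∀ x, G x = c • x + D x + B x x - F := ⟨_, fun _ => rfl⟩
  have taylor : ∀ h, G (x₀ + h) = L h + B h h := by
    intro h
    rw [hG, hL, add_apply, hK, ← hx₀, smul_add, map_add, hBadd_l, hBadd_r, hBadd_r]
    abel
  have hW : ∀ N y, G (P N x₀ + y) - L y =
      L (P N x₀ - x₀) + B (P N x₀ - x₀ + y) (P N x₀ - x₀ + y) := by
    intro N y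
    have : P N x₀ + y = x₀ + (P N x₀ - x₀ + y) := by abel
    rw [this, taylor, map_add]; abel
  -- `G (P N x₀) → G x₀ = 0` and `‖P N x₀ - x₀‖ → 0`
  have hGc : Continuous G := by
    have hBc : Continuous fun x : E => B x x := hB.continuous.comp₂ continuous_id' continuous_id'
    rw [show G = fun x => c • x + D x + B x x - F from funext hG]
    exact (((continuous_id'.const_smul c).add D.continuous).add hBc).sub continuous_const
  have hG0 : Tendsto (fun N => G (P N x₀)) atTop (𝓝 0) := by
    have h := (hGc.tendsto x₀).comp (hP3 x₀)
    rwa [hG x₀, hx₀, sub_self] at h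
  have he0 : Tendsto (fun N => ‖P N x₀ - x₀‖) atTop (𝓝 0) :=
    tendsto_zero_iff_norm_tendsto_zero.1 (tendsto_sub_nhds_zero_iff.2 (hP3 x₀))
  -- the radius `ρ` and the tail size `δ`
  obtain ⟨ρ, hρ0, hρ⟩ : ∃ ρ : ℝ, 0 < ρ ∧ 2 * M * Cb * ρ ≤ 1 / 8 := by
    refine ⟨1 / (16 * (M * Cb + 1)), by positivity, ?_⟩
    rw [mul_one_div, div_le_div_iff₀ (by positivity) (by norm_num)]
    nlinarith [mul_nonneg hM0 hCb0.le]
  obtain ⟨δ, hδ0, hδ⟩ : ∃ δ : ℝ, 0 < δ ∧ M * δ ≤ 1 / 8 := by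
    refine ⟨1 / (8 * (M + 1)), by positivity, ?_⟩
    rw [mul_one_div, div_le_div_iff₀ (by positivity) (by norm_num)]
    nlinarith
  -- eventually: tails small (twice), `P N x₀` close to `x₀`, `G (P N x₀)` small
  have ht1 := gnk_tails (D + K) P hcpt hP2 hP3 (half_pos (abs_pos.2 hc))
  have ht2 := gnk_tails (D + K) P hcpt hP2 hP3 hδ0
  have he1 : ∀ᶠ N in atTop, 2 * M * Cb * ‖P N x₀ - x₀‖ ≤ 1 / 8 := by
    have h := he0.const_mul (2 * M * Cb)
    rw [mul_zero] at h
    exact h.eventually (ge_mem_nhds (by norm_num))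
  have hg1 : ∀ᶠ N in atTop, M * ‖G (P N x₀)‖ ≤ ρ / 2 := by
    have h := (tendsto_zero_iff_norm_tendsto_zero.1 hG0).const_mul M
    rw [mul_zero] at h
    exact h.eventually (ge_mem_nhds (by positivity))
  -- one Galerkin zero `P N x₀ + y` for every large `N`
  have hev : ∀ᶠ N in atTop, ∃ y, P N y = y ∧ ‖y‖ ≤ 2 * M * ‖G (P N x₀)‖ ∧
      P N (G (P N x₀ + y)) = 0 := by
    filter_upwards [ht1, ht2, he1, hg1] with N h1 h2 h3 h4
    have hκ : ∀ y₁ y₂, ‖y₁‖ ≤ ρ → ‖y₂‖ ≤ ρ →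
        ‖(G (P N x₀ + y₁) - L y₁) - (G (P N x₀ + y₂) - L y₂)‖ ≤
          2 * Cb * (‖P N x₀ - x₀‖ + ρ) * ‖y₁ - y₂‖ := fun y₁ y₂ n₁ n₂ => by
      rw [hW, hW, add_sub_add_left_eq_sub]
      exact gnk_quadLipschitz B hCb0.le hCb hBsub_l hBsub_r _ y₁ y₂ n₁ n₂
    have hcontr : M * (δ + 2 * Cb * (‖P N x₀ - x₀‖ + ρ)) ≤ 1 / 2 := by
      have : M * (δ + 2 * Cb * (‖P N x₀ - x₀‖ + ρ)) =
          M * δ + 2 * M * Cb * ‖P N x₀ - x₀‖ + 2 * M * Cb * ρ := by ring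
      rw [this]; linarith
    obtain ⟨y, hPy, hyb, hfix⟩ :=
      gnk_chord L (D + K) (P N) G (P N x₀) hL hM0 hMle (hP1 N) (hP2 N) h2 hκ hρ0.le hcontr h4
    exact ⟨y, hPy, hyb,
      gnk_injective L (D + K) (P N) hL h1 (half_lt_self (abs_pos.2 hc)) (hP1 N _) hfix⟩
  -- assemble the sequence
  obtain ⟨N₀, hN₀⟩ := eventually_atTop.1 hev
  choose! y hy using hN₀
  obtain ⟨x, hx⟩ : ∃ x : ℕ → E, ∀ N, x N = P N x₀ + y N := ⟨_, fun _ => rfl⟩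
  refine ⟨x, eventually_atTop.2 ⟨N₀, fun N hN => ?_⟩, ?_⟩
  · obtain ⟨hPy, -, hGy⟩ := hy N hN
    rw [hG, map_sub, sub_eq_zero] at hGy
    rw [hx]
    exact ⟨by rw [map_add, hP1, hPy], hGy⟩
  · rw [← tendsto_sub_nhds_zero_iff]
    have hbound : ∀ᶠ N in atTop, ‖x N - x₀‖ ≤ ‖P N x₀ - x₀‖ + 2 * M * ‖G (P N x₀)‖ := by
      refine eventually_atTop.2 ⟨N₀, fun N hN => ?_⟩
      obtain ⟨-, hyb, -⟩ := hy N hN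
      calc ‖x N - x₀‖ = ‖(P N x₀ - x₀) + y N‖ := by rw [hx]; congr 1; abel
        _ ≤ ‖P N x₀ - x₀‖ + ‖y N‖ := norm_add_le _ _
        _ ≤ ‖P N x₀ - x₀‖ + 2 * M * ‖G (P N x₀)‖ := by gcongr
    refine squeeze_zero_norm' hbound ?_
    have h := he0.add ((tendsto_zero_iff_norm_tendsto_zero.1 hG0).const_mul (2 * M))
    simpa using h

end Summit.AnomalousDissipation.AnomalousDissipation.Theorems.WindLineWindyGalerkinSteadyZerothLaw

end
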